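import Literature.NumberTheory.GaloisRepresentations.HomDualRestrictField
import Literature.NumberTheory.GaloisRepresentations.ContinuousCohomologyConnectingNaturality
import Literature.NumberTheory.GaloisRepresentations.ContinuousH1ResCocycle
import Literature.NumberTheory.GaloisRepresentations.BrauerTower
import HarnessLib

/-!
# Naturality of the dual connecting map `δ₀` under restriction of the field and change of coefficients

Topic `NumberTheory/GaloisRepresentations`; namespaces `Literature.NumberTheory.GaloisRepresentations.IsSES` (§1)
and `…HomDual` (§2–3).  Definitions with bodies and theorems; no named fact, no instance, no `sorry`.

§1 (generic).  For a continuous homomorphism `θ : Γ' → Γ`, a short exact sequence `0 → M₁ → M₂ → M₃ → 0`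
of discrete `Γ`-modules, one `0 → M₁' → M₂' → M₃' → 0` of discrete `Γ'`-modules and `θ`-equivariant maps
`φᵢ : Mᵢ → Mᵢ'` forming commutative squares, the connecting maps satisfy
`H¹(θ, φ₁) (δ₀ v) = δ₀' (φ₃ v)` for every `Γ`-invariant `v ∈ M₃` (NSW (1.3.3) with change of group,
(1.5.2) compatibility of `res` with `δ`).

§2–3 (the Hom-dual of a presentation, sequel to `HomDualPresentation`, `HomDualRestrictField`).  For
`0 → X → Y → Z → 0` over `K`, coefficients `A` over `K`, a field `K'/K` (`ι : K̄ → K̄'`, `res : Γ_{K'} → Γ_K`)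
and a `Γ_{K'}`-equivariant coefficient transfer `j : A|_{K'} → A'`, post-composition with `j` maps
`Hom(V, A)|_{K'} → Hom(V|_{K'}, A')` (`postcompResHom`) and

  `H¹(res, j∘–) (dualδ₀_K h) = dualδ₀_{K'} (j ∘ h)`  (`map_dualδ₀_eq`),

i.e. the native dual connecting map commutes with restriction to `K'` followed by the coefficient change —
the `(R2)` compatibility `R_v (h ≫ ι) = loc_v (δ₀ h)` of the presentation road (door-c6 g16), once `K' = K_v`,
`A = K̄ˣ`, `A' = K̄_vˣ`.

References: Neukirch–Schmidt–Wingberg, *Cohomology of Number Fields* (1.3.3), (1.5.2); Serre, *Galois Cohomology*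
I §2.2, §2.4; Milne, *Arithmetic Duality Theorems* I §0.
-/

noncomputable section

namespace Literature.NumberTheory.GaloisRepresentations

open Function ContRepresentation

universe u

/-! ## §1 `δ₀` commutes with change of group -/

namespace IsSES

variable {Γ Γ' : Type u} [Group Γ] [TopologicalSpace Γ] [IsTopologicalGroup Γ]
  [Group Γ'] [TopologicalSpace Γ'] [IsTopologicalGroup Γ']
variable {M₁ M₂ M₃ M₁' M₂' M₃' : Type u}
  [AddCommGroup M₁] [TopologicalSpace M₁] [DiscreteTopology M₁]
  [AddCommGroup M₂] [TopologicalSpace M₂] [DiscreteTopology M₂]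
  [AddCommGroup M₃] [TopologicalSpace M₃] [DiscreteTopology M₃]
  [AddCommGroup M₁'] [TopologicalSpace M₁'] [DiscreteTopology M₁']
  [AddCommGroup M₂'] [TopologicalSpace M₂'] [DiscreteTopology M₂']
  [AddCommGroup M₃'] [TopologicalSpace M₃'] [DiscreteTopology M₃']
variable {ρ₁ : ContinuousRep Γ ℤ M₁} {ρ₂ : ContinuousRep Γ ℤ M₂} {ρ₃ : ContinuousRep Γ ℤ M₃}
variable {ρ₁' : ContinuousRep Γ' ℤ M₁'} {ρ₂' : ContinuousRep Γ' ℤ M₂'} {ρ₃' : ContinuousRep Γ' ℤ M₃'}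
variable {f : ρ₁.toTopRep ⟶ ρ₂.toTopRep} {g : ρ₂.toTopRep ⟶ ρ₃.toTopRep}
variable {f' : ρ₁'.toTopRep ⟶ ρ₂'.toTopRep} {g' : ρ₂'.toTopRep ⟶ ρ₃'.toTopRep}
variable (θ : Γ' →ₜ* Γ)
  (φ₁ : TopRep.res (θ : Γ' →* Γ) ρ₁.toTopRep ⟶ ρ₁'.toTopRep)
  (φ₂ : TopRep.res (θ : Γ' →* Γ) ρ₂.toTopRep ⟶ ρ₂'.toTopRep)
  (φ₃ : TopRep.res (θ : Γ' →* Γ) ρ₃.toTopRep ⟶ ρ₃'.toTopRep)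

omit [IsTopologicalGroup Γ] [IsTopologicalGroup Γ'] in
/-- A `θ`-equivariant map carries `Γ`-invariants of `M₃` to `Γ'`-invariants of `M₃'`.
[cite: NeukirchSchmidtWingberg2008, (1.5.2)] -/
theorem mem_invariants_map_res (v : ρ₃.toTopRep.ρ.invariants) :
    φ₃.hom (v : M₃) ∈ ρ₃'.toTopRep.ρ.invariants := fun σ => by
  rw [← TopRep.hom_comm_apply φ₃ σ]
  exact congrArg φ₃.hom (v.2 (θ σ))

/-- **`δ₀` commutes with change of group**: for `θ : Γ' → Γ`, short exact sequences `(f, g)` over `Γ` and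
`(f', g')` over `Γ'` and `θ`-equivariant `φ₁, φ₂, φ₃` with `φ₂ f = f' φ₁`, `φ₃ g = g' φ₂`, one has
`H¹(θ, φ₁) (δ₀ v) = δ₀' (φ₃ v)` (the image `φ₂ w` of a lift `w` of `v` lifts `φ₃ v`, and
`φ₁ (f⁻¹((θσ) w − w)) = f'⁻¹(σ (φ₂ w) − φ₂ w)`). [cite: NeukirchSchmidtWingberg2008, (1.3.3), (1.5.2)]
[cite: SerreGaloisCohomology1997, I §2.2, §2.4] -/
theorem map_res_δ₀ (h : IsSES f g) (h' : IsSES f' g')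
    (hsq₁ : ∀ x, φ₂.hom (f.hom x) = f'.hom (φ₁.hom x))
    (hsq₂ : ∀ y, φ₃.hom (g.hom y) = g'.hom (φ₂.hom y))
    (v : ρ₃.toTopRep.ρ.invariants) :
    ContinuousCohomology.map θ φ₁ 1 (h.δ₀ v) =
      h'.δ₀ ⟨φ₃.hom (v : M₃), mem_invariants_map_res θ φ₃ v⟩ := by
  have hw : g.hom (h.lift v.1) = v := h.g_lift v.1
  have hw' : g'.hom (φ₂.hom (h.lift v.1)) = φ₃.hom (v : M₃) := by rw [← hsq₂, hw]
  rw [h.δ₀_apply_eq v (h.lift v.1) hw, h'.δ₀_apply_eq _ (φ₂.hom (h.lift v.1)) hw',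
    map_oneCocycleClass]
  refine congrArg _ (Subtype.ext (ContinuousMap.ext fun σ => h'.injective ?_))
  change f'.hom (φ₁.hom ((h.δ₀Cocycle _ (by rw [hw]; exact v.2)).1 (θ σ))) = _
  rw [h'.f_δ₀Cocycle_apply, ← hsq₁, h.f_δ₀Cocycle_apply, map_sub]
  congr 1
  exact TopRep.hom_comm_apply φ₂ σ _

end IsSES

/-! ## §2 Post-composition with a coefficient transfer `j : A|_{K'} → A'` -/

namespace HomDual

open Literature.Algebra.Homology Literature.Algebra.Homology.DiscreteRep Field DiscreteGaloisModule

variable {K : Type} [Field K] {K' : Type} [Field K'] [Algebra K K']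
variable {X Y Z W W' : Type}
  [AddCommGroup X] [TopologicalSpace X] [DiscreteTopology X] [Module.Finite ℤ X]
  [AddCommGroup Y] [TopologicalSpace Y] [DiscreteTopology Y] [Module.Finite ℤ Y]
  [AddCommGroup Z] [TopologicalSpace Z] [DiscreteTopology Z] [Module.Finite ℤ Z]
  [AddCommGroup W] [TopologicalSpace W] [DiscreteTopology W]
  [AddCommGroup W'] [TopologicalSpace W'] [DiscreteTopology W']
variable (ρX : DiscreteGaloisModule K X) (ρY : DiscreteGaloisModule K Y) (ρZ : DiscreteGaloisModule K Z)
  (ρA : DiscreteGaloisModule K W) (ρA' : DiscreteGaloisModule K' W')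
  (j : (ρA.restrictField K').toContRepresentation →ⁱL ρA'.toContRepresentation)

/-- Post-composition with `j` on carriers: `Hom_ℤ(V, A) → Hom_ℤ(V, A')`, `F ↦ j ∘ F`. [cite: MilneADT2006, I §0] -/
def postcompAddHom : DiscreteRep.HomCarrier Z W →+ DiscreteRep.HomCarrier Z W' where
  toFun F := (j.toContinuousLinearMap.toLinearMap ∘ₗ (show Z →ₗ[ℤ] W from F) : Z →ₗ[ℤ] W')
  map_zero' := LinearMap.ext fun _ => by
    change j 0 = 0
    exact map_zero j
  map_add' F G := LinearMap.ext fun z => by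
    change j ((show Z →ₗ[ℤ] W from F) z + (show Z →ₗ[ℤ] W from G) z) = _
    exact map_add j _ _

omit [TopologicalSpace Z] [DiscreteTopology Z] [Module.Finite ℤ Z] in
/-- Unfolding: `(postcompAddHom j F) z = j (F z)`. [cite: MilneADT2006, I §0] -/
@[simp] theorem postcompAddHom_apply (F : DiscreteRep.HomCarrier Z W) (z : Z) :
    (show Z →ₗ[ℤ] W' from postcompAddHom (Z := Z) ρA ρA' j F) z = j ((show Z →ₗ[ℤ] W from F) z) := rfl

/-- `j` is `Γ_{K'}`-equivariant: `j (A(res σ) a) = A' σ (j a)`. [cite: MilneADT2006, I §0] -/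
theorem transfer_apply (σ : absoluteGaloisGroup K') (a : W) :
    j (ρA (absGaloisRestrict K K' σ) a) = ρA' σ (j a) := by
  have := j.isIntertwining σ a
  simpa [ContinuousRep.toContRepresentation_apply_apply, GaloisRep.restrictField_apply] using this

/-- **`F ↦ j ∘ F : Hom_ℤ(V, A)|_{K'} → Hom_ℤ(V|_{K'}, A')` is `res`-equivariant**:
`j ∘ ((res σ) F (res σ)⁻¹) = σ (j ∘ F) σ⁻¹`. [cite: MilneADT2006, I §0] -/
theorem postcompAddHom_smul (σ : absoluteGaloisGroup K') (F : DiscreteRep.HomCarrier Z W) :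
    postcompAddHom ρA ρA' j (homGaloisModule ρZ ρA (absGaloisRestrict K K' σ) F) =
      homGaloisModule (ρZ.restrictField K') ρA' σ (postcompAddHom ρA ρA' j F) := by
  refine LinearMap.ext fun z => ?_
  change j (ρA (absGaloisRestrict K K' σ) ((show Z →ₗ[ℤ] W from F) (ρZ (absGaloisRestrict K K' σ)⁻¹ z))) =
    ρA' σ (j ((show Z →ₗ[ℤ] W from F) ((ρZ.restrictField K') σ⁻¹ z)))
  rw [GaloisRep.restrictField_apply, map_inv (absGaloisRestrict K K') σ]
  exact transfer_apply ρA ρA' j σ _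

/-- **Post-composition with `j` as a `res`-equivariant morphism `Hom_ℤ(V, A) → Hom_ℤ(V|_{K'}, A')` in `TopRep`**
(the shape `ContinuousCohomology.map res` consumes). [cite: MilneADT2006, I §0] -/
def postcompResHom :
    TopRep.res ((absGaloisRestrict K K' : absoluteGaloisGroup K' →ₜ* absoluteGaloisGroup K) :
        absoluteGaloisGroup K' →* absoluteGaloisGroup K) (homGaloisModule ρZ ρA).toTopRep ⟶
      (homGaloisModule (ρZ.restrictField K') ρA').toTopRep :=
  TopRep.ofHom ⟨⟨(postcompAddHom ρA ρA' j (Z := Z)).toIntLinearMap, continuous_of_discreteTopology⟩, fun σ => by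
    refine ContinuousLinearMap.ext fun F => ?_
    exact postcompAddHom_smul ρZ ρA ρA' j σ F⟩

/-- Unfolding `postcompResHom` on elements. [cite: MilneADT2006, I §0] -/
@[simp] theorem postcompResHom_apply (F : DiscreteRep.HomCarrier Z W) :
    (postcompResHom ρZ ρA ρA' j).hom F = postcompAddHom ρA ρA' j F := rfl

/-- The same map as a morphism of discrete `Γ_{K'}`-modules out of the restricted module `Hom_ℤ(V, A)|_{K'}`
(the shape `galoisCohomology.map` consumes). [cite: MilneADT2006, I §0] -/
def postcompRes :
    ((homGaloisModule ρZ ρA).restrictField K').toContRepresentation →ⁱL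
      (homGaloisModule (ρZ.restrictField K') ρA').toContRepresentation where
  toLinearMap := (postcompAddHom ρA ρA' j (Z := Z)).toIntLinearMap
  cont := continuous_of_discreteTopology
  isIntertwining' σ := by
    refine ContinuousLinearMap.ext fun F => ?_
    simpa [ContinuousRep.toContRepresentation_apply_apply, GaloisRep.restrictField_apply] using
      postcompAddHom_smul ρZ ρA ρA' j σ F

/-- Unfolding `postcompRes` on elements. [cite: MilneADT2006, I §0] -/
@[simp] theorem postcompRes_apply (F : DiscreteRep.HomCarrier Z W) :
    postcompRes ρZ ρA ρA' j F = postcompAddHom ρA ρA' j F := rfl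

/-- **`H(res, j∘–) = H(j∘–) ∘ res`**: the single change-of-group map along `postcompResHom` is restriction to `K'`
followed by the coefficient map `postcompRes`. [cite: NeukirchSchmidtWingberg2008, (1.5.2)] -/
theorem map_postcompResHom_eq (q : ℕ) (x : galoisCohomology (homGaloisModule ρZ ρA) q) :
    ContinuousCohomology.map (absGaloisRestrict K K') (postcompResHom ρZ ρA ρA' j) q x =
      galoisCohomology.map (postcompRes ρZ ρA ρA' j) q
        (galoisCohomology.res (homGaloisModule ρZ ρA) K' q x) :=
  map_comp_apply_of (absGaloisRestrict K K') (ContinuousMonoidHom.id _) (absGaloisRestrict K K') (fun _ => rfl)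
    _ _ _ (fun _ => rfl) q x

/-! ## §3 `dualδ₀` commutes with restriction-and-transfer -/

variable (i : ρX.toContRepresentation →ⁱL ρY.toContRepresentation)
  (p : ρY.toContRepresentation →ⁱL ρZ.toContRepresentation)

/-- The transferred equivariant map `j ∘ h : X|_{K'} → A'` of an equivariant `h : X → A`, as an invariant of
`Hom_ℤ(X|_{K'}, A')`. [cite: MilneADT2006, I §0] -/
def transferInvariant (h : (homGaloisModule ρX ρA).toTopRep.ρ.invariants) :
    (homGaloisModule (ρX.restrictField K') ρA').toTopRep.ρ.invariants :=
  ⟨postcompAddHom ρA ρA' j (h.1 : DiscreteRep.HomCarrier X W),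
    IsSES.mem_invariants_map_res (absGaloisRestrict K K') (postcompResHom ρX ρA ρA' j) h⟩

/-- Unfolding `transferInvariant`. [cite: MilneADT2006, I §0] -/
@[simp] theorem coe_transferInvariant (h : (homGaloisModule ρX ρA).toTopRep.ρ.invariants) :
    (transferInvariant ρX ρA ρA' j h : DiscreteRep.HomCarrier X W') =
      postcompAddHom ρA ρA' j (h.1 : DiscreteRep.HomCarrier X W) := rfl

/-- **`dualδ₀` commutes with restriction of the field and transfer of coefficients** (single-map form):
`H¹(res, j∘–) (dualδ₀_K h) = dualδ₀_{K'} (j ∘ h)` for the dual sequences of `0 → X → Y → Z → 0` over `K`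
(coefficients `A`) and of its restriction over `K'` (coefficients `A'`).
[cite: NeukirchSchmidtWingberg2008, (1.3.3), (1.5.2)] [cite: MilneADT2006, I §0] -/
theorem map_dualδ₀_eq (hS : IsSES (toTopRepHom ρX ρY i) (toTopRepHom ρY ρZ p)) (hW : Module.Baer ℤ W)
    (hW' : Module.Baer ℤ W') (h : (homGaloisModule ρX ρA).toTopRep.ρ.invariants) :
    ContinuousCohomology.map (absGaloisRestrict K K') (postcompResHom ρZ ρA ρA' j) 1
        (dualδ₀ ρX ρY ρZ ρA i p hS hW h) =
      dualδ₀ (ρX.restrictField K') (ρY.restrictField K') (ρZ.restrictField K') ρA'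
        (restrictIntertwining ρX ρY i) (restrictIntertwining ρY ρZ p) (isSES_restrict ρX ρY ρZ hS) hW'
        (transferInvariant ρX ρA ρA' j h) := by
  rw [dualδ₀_apply, dualδ₀_apply]
  exact IsSES.map_res_δ₀ (absGaloisRestrict K K') (postcompResHom ρZ ρA ρA' j) (postcompResHom ρY ρA ρA' j)
    (postcompResHom ρX ρA ρA' j) _ _ (fun _ => rfl) (fun _ => rfl) h

/-- **`dualδ₀` commutes with restriction of the field and transfer of coefficients** (`res`-then-`map` form):
`H¹(j∘–) (res_{K'/K} (dualδ₀_K h)) = dualδ₀_{K'} (j ∘ h)`. [cite: NeukirchSchmidtWingberg2008, (1.3.3), (1.5.2)]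
[cite: MilneADT2006, I §0] -/
theorem map_res_dualδ₀_eq (hS : IsSES (toTopRepHom ρX ρY i) (toTopRepHom ρY ρZ p)) (hW : Module.Baer ℤ W)
    (hW' : Module.Baer ℤ W') (h : (homGaloisModule ρX ρA).toTopRep.ρ.invariants) :
    galoisCohomology.map (postcompRes ρZ ρA ρA' j) 1
        (galoisCohomology.res (homGaloisModule ρZ ρA) K' 1 (dualδ₀ ρX ρY ρZ ρA i p hS hW h)) =
      dualδ₀ (ρX.restrictField K') (ρY.restrictField K') (ρZ.restrictField K') ρA'
        (restrictIntertwining ρX ρY i) (restrictIntertwining ρY ρZ p) (isSES_restrict ρX ρY ρZ hS) hW'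
        (transferInvariant ρX ρA ρA' j h) := by
  rw [← map_postcompResHom_eq, map_dualδ₀_eq]

end HomDual

end Literature.NumberTheory.GaloisRepresentations

end
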